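import Mathlib
import HarnessLib
import Summits.BirchSwinnertonDyer.BirchSwinnertonDyer.Theses.ManinLocalTwoThree
import Summits.BirchSwinnertonDyer.BirchSwinnertonDyer.Theorems.ManinLocalTwoThreeManinOddAtFourKernelSplit
import Literature.NumberTheory.Automorphic.UnboundedDenominators
import Summits.BirchSwinnertonDyer.BirchSwinnertonDyer.Theorems.ManinLocalTwoThreeSquareRootDescent
import Literature.NumberTheory.EllipticCurves.KatoAdditiveTwistedValueNeronIntegralityTwoReal
import Literature.NumberTheory.EllipticCurves.KatoAdditiveTwistedValueNeronIntegralitySymbolClosure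
import Literature.NumberTheory.EllipticCurves.Gamma1ParametrizationCuspRationality
import Literature.NumberTheory.EllipticCurves.Gamma1ParametrizationCuspZeroGaloisOrbit
import Literature.NumberTheory.EllipticCurves.ManinConstantGamma1Gamma0Comparison

/-!
# Lines/kato_shift_two.lean — v27 REGISTERED by the LEAD (p1 gen 18, 2026-08-29T23:1xZ) = p3 g18's v27 candidate VERBATIM below (sha16 dedc76005585b77e): THE
# KERNEL SPLIT.  Stubs (6): PRINTED {printedKatoFacts, printedCuspFacts, CDT_algInt}; OPEN {I4 = `stub_shimuraIndexNeFourOnCoreG` (index ≠ 4 on G),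
# K♭ = `stub_blindRationalRootOnCoreG` (a BLIND rational 2-division root on index-2 gain classes), 6♭‴|_G = `stub_katoNeronIntegralTwoGamma1OptimalOnBlindCoreG`}.
# NECESSITY (LEAD-MEMO v37 §3, all kernel theorems): I4 ⟸ C2 (E-an-68 `index_ne_four_of_not_two_dvd_maninConstant`); K♭ ⟸ «no doubling» ⟸ C2
# (`shimuraKernelBlindAt_of_natAbs_eq`, p713937, and `exists_kummerBlind_root_of_not_two_dvd_of_ne`, p749756); 6♭‴|_G ⟹ «c₁ odd» ⟸ C2 (ledger).  So v27's
# rows are C2|_G's own two ledger bits plus index-4 exclusion: the line has CONVERGED (v28 = p3's exactness certificate `maninOddAtFour_iff_kernelLawsG` with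
# 6♭‴ weakened to Stevens parity, when it lands).  HONEST FRAMING: CONDITIONAL reduction; I4, K♭, 6♭‴|_G OPEN; CDT/F♯/F★/F♮/CES/F-es-21♭K printed only;
# BSD is not proved; Manin's conjecture at 2 is not proved.  p3's candidate text:
#
# Lines/kato_shift_two.lean — v27 CANDIDATE (p3 gen 18, 2026-08-29T23:3xZ; for the LEAD's custody): THE KERNEL SPLIT — on the gain locus G the
# cuspidal-Kummer certificate laws 6a‴|_G / 6b-res|_G are REPLACED by two rows about Stevens' curve, fed by UDC₂ applied to EVERY rational root
# (composition `Theorems/ManinLocalTwoThreeManinOddAtFourKernelSplit.lean`, p3 g18): assuming `2 ∣ c` on G, index 4 contradicts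
# **I4 = `stub_shimuraIndexNeFourOnCoreG`** (E-an-152b `ShimuraIndexNeFourAtFour(B)` + gain/core/16 binders); otherwise **K♭ = `stub_blindRationalRootOnCoreG`**
# (E-an-152 `ShimuraKernelBlindAtFour(B)` weakened: «an index-2 gain class has a BLIND rational 2-division root», ℘-clause dropped) gives a blind root `E`;
# a second rational root makes BOTH σ-square roots Γ₁(N)-periodic (p2's AN2₂ THEOREM `UDCTwo.sqRootWitnessLaw` + CDT) hence index 4 (LEAD's
# `FullTwoTorsion.not_two_dvd_maninConstant_of_two_roots_of_not_indexFour`) — contradiction; else the curve is TOTALLY BLIND and the v23 blind road with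
# **6♭‴|_G** closes.  STUBS (6): printedKatoFacts · printedCuspFacts · CDT_algInt (PRINTED, cite-only) · I4 · K♭ · 6♭‴|_G (OPEN rows; I4/K♭ are -an's
# E-an-152b|_B / E-an-152|_B restricted further — `KernelSplit.indexNeFourG_of_B`, `KernelSplit.blindRootG_of_kernelBlindB`).  NO η-quotient /
# generalized-Ogg input remains (6a‴'s plain-η form at 16 ∣ N was -an's own hedge).  Census: 21 gain classes at 16 ∣ N (N ≤ 80153) all index 2 (I4 ✓);
# kernel root blind 19/19 at 4 ∣ N ≤ 2000 (K♭ ✓, -an §87).  HONEST FRAMING: CONDITIONAL reduction; the three rows are OPEN; CDT and the cusp/Kato facts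
# are printed, not proved here; BSD is not proved; Manin's conjecture at 2 is not proved.  v26 text:
#
# Lines/kato_shift_two.lean — v26 CANDIDATE (p3 gen 18, 2026-08-29T22:4xZ; for the LEAD's custody): v25 with THE STEVENS SPLIT — the composition
# (`Theorems/ManinLocalTwoThreeManinOddAtFourStevensSplit.lean`, p747777) splits on `Λ₁(f) = Λ₀(f)` (Stevens' `X₁(N)`-optimal curve = the optimal curve)
# instead of on the cusp `0`: there `hEven` (UDC₂: `2 ∣ c ⟹ Λ₁ ≠ Λ₀`, from AN2₂ ∧ CDT) bites WITHOUT Θ; so the three laws are consumed ONLY on the GAIN LOCUS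
# G = {`Λ₁(f) ≠ Λ₀(f)`} ∩ core ∩ {`16 ∣ N`} and each law stub carries ONE MORE binder `periodLatticeGamma1 D.f ≠ periodLattice D.f` (6♭‴: inside the guard,
# on `D₀.f`) on top of v25's `modularSymbol D.f 0 ∉ periodLattice D.f` (still derived on G by Θ's contrapositive); AND v25's `stub_sqRootWitnessLawTwo`
# (AN2₂) is CLOSED BY NAME — p2 g19's THEOREM `UDCTwo.sqRootWitnessLaw` (p747828) has literally its type (`sqRootWitnessLawTwo_of_tree`, no sorry).
# STUBS (6, names …OnCoreG): printedKatoFacts, printedCuspFacts, CDT_algInt (PRINTED, cite-only) · 6a‴|_G, 6b-res|_G, 6♭‴|_G (OPEN laws, STRICTLY WEAKER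
# than v25's B-forms).  C2's open content after v26 = three laws on the GAIN LOCUS + printed facts.  Census habitat of the laws: es E15 gain classes at `16 ∣ N` (`N ≤ 80153`): 21 classes (32a1 48a1 64a1 80a1 80b1 128b1 128d1 208c1
# 464e1 848d1 2768c1 3664f1 4688b1 11728d1 17488a1 19664g1 21968e1 32464a1 35408e1 52048a1 71888e1; all index 2, rank 0) instead of every rank-0 class.
# HONEST FRAMING: CONDITIONAL reduction; the three G-laws are OPEN, the printed facts are not proved in the tree; BSD is not proved; Manin's
# conjecture at 2 is not proved.  v25 text:
#
# Lines/kato_shift_two.lean — v25 (lead p1 gen 18, 2026-08-29T22:5xZ): v24's coarse stub UDC₂ SPLIT into its PRINTED engine and its one OPEN analytic piece —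
# `stub_CDT_algInt` (Calegari–Dimitrov–Tang 2025, the same printed stub as C3 v34) and `stub_sqRootWitnessLawTwo` = **AN2₂, the ℓ = 2 WITNESS LAW** (p2 g19's
# binder `hWL` of `UDCGlueTwo.periodLatticeGamma1_ne_of_two_dvd_of_sqRootWitnessLaw`, VERBATIM: every `2`-adically integral normalised square root of `Ξ_T` has
# a holomorphic weight-`k` witness with algebraic-integer `q`-expansion, exponential growth at the cusps and `Γ₀(N)`-stabiliser the period group of `V_a`).
# BI₂ (p2 `kummerSqRoot_twoAdicallyIntegral`), NC₂-a/NC₂-glue (p2), the ℓ = 2 endgame (LEAD p746256/p746594), Θ (LEAD p745958) and Kurth–Long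
# (`typeIINoncongruence_holds`) are all THEOREMS; composition = `WitnessSplit.maninOddAtFour_of_katoFact_sqRootWitnessLaw_CDT_levelSixteenCoreLawsB`
# (`…ManinOddAtFourWitnessSplit`, p747195).  STUBS (7 = stubs_max): printedKatoFacts (F♯ ∧ F-es-21♭K), printedCuspFacts (F★ ∧ F♮ ∧ CES), CDT_algInt — PRINTED;
# sqRootWitnessLawTwo (AN2₂), 6a‴|_B, 6b-res|_B, 6♭‴|_B — OPEN.  So C2's open content = ONE analytic witness law on the reducible half of locus A (the ℓ = 2 port of
# ~10 landed ℓ = 3 files) + the three v23 laws on locus B (analytic rank 0, cuspidal point of even order).  HONEST FRAMING: CONDITIONAL reduction; BSD is not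
# proved; Manin's conjecture at 2 is not proved.  v24 text:

# Lines/kato_shift_two.lean — v24 (lead p1 gen 18, 2026-08-29T22:2xZ): THE CUSP-ZERO SPLIT — locus A `{∞,0}_f ∈ Λ₀(f)` (⊇ ROOT NUMBER −1) is closed by
# F♯ (irreducible) and the NEW ℓ = 2 UDC CONGRUENCE LAW `stub_udcTwoCongruence` (reducible); the three v23 laws are now needed ONLY on locus B
# `{∞,0}_f ∉ Λ₀(f)` (analytic rank 0, cuspidal point of even order) — each carries that extra binder (STRICTLY WEAKER stubs).
# WHY (all kernel theorems of this gen): Θ at m = 1 (`…StevensCurveOfCuspZero`, p745958): `{∞,0}_f ∈ Λ₀ ⟹ Λ₁ = Λ₀` mod F★∧F♮∧CES; the ℓ = 2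
# Kummer-character endgame (`…KummerSquareCharacterEndgame` p746256, `…SigmaSqRootKummerShimuraTwo` p746594): Γ₁(N)-periodicity of the σ-square root
# of `x − x(T)` ⟹ `Λ₁ ≠ Λ₀`; p2 g19's NC₂-a + Kurth–Long glue (`…KummerCoverSubgroupTwo`, `UDCTwo.sigmaSqRoot_gamma1_periodic_of_congruence`):
# congruence ⟹ Γ₁(N)-periodicity.  So on A: `2 ∣ c` ⟹ (UDC₂) congruence ⟹ `Λ₁ ≠ Λ₀` ⟹ contradiction.  COMPOSITION =
# `RootNumberSplit.maninOddAtFour_of_katoFact_udcTwo_levelSixteenCoreLawsB` (`…ManinOddAtFourRootNumberSplit`, p746903).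
# STUBS (6 ≤ stubs_max): `stub_printedKatoFacts` (F♯ ∧ F-es-21♭K, Kato 2004 — PRINTED), `stub_printedCuspFacts` (F★ ∧ F♮ ∧ CES, CES 2003 / Stevens 1982 —
# PRINTED), `stub_udcTwoCongruence` (OPEN: = BI₂ ∧ AN₂ ∧ CDT, the ℓ = 2 twin of C3's (BI) ∧ (AN♮) ∧ CDT which are theorems/print at ℓ = 3; p2 g19 holds BI₂,
# AN₂ untaken, objects to be typed T-p1-g18-1), `stub_cuspidalKummerRepresentativeOnCoreG` (6a‴|_B), `stub_cuspidalKummerEvenExponentSquareOnCoreG`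
# (6b-res|_B), `stub_katoNeronIntegralTwoGamma1OptimalOnBlindCoreG` (6♭‴|_B) — the v23 laws VERBATIM with the added hypothesis
# `modularSymbol D.f 0 ∉ periodLattice D.f` (resp. inside 6♭‴'s guard).  HONEST FRAMING: CONDITIONAL reduction; UDC₂ and the three B-laws are OPEN;
# BSD is not proved; Manin's conjecture at 2 is not proved.  v23 text (kept for the record):
# Lines/kato_shift_two.lean — v23 (lead p1 gen 16, 2026-08-29T17:0xZ): v22 BY NAME — the 6b-res stub now names the TREE law
# `CuspidalKummer.CuspidalKummerEvenExponentSquareOnCore` (-an g38 T-an-46, typer p733352 `ManinAdditive/CuspidalKummerEvenResidual.lean`; = v22's inline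
# text = p2's `hL` VERBATIM, ref1 §R176 CLEAN AS TYPED, 6b-res ⟺ 6b‴ via p2's `SquareRootDescent` p724791).  ALL SEVEN STUBS ARE NAMED TREE DECLARATIONS again:
# {F♯ `kato_neron_isIntegral_twistedSymbolSum_of_additive_two_real`, F★ `optimalGamma1Parametrization_cusp_rational`, F-need `exists_optimal_gamma1ParametrizationData`,
# F-es-21♭K `kato_isIntegral_twistedSymbolSum_two_symbolClosure` (four PRINTED statement-only facts), 6a‴ `CuspidalKummerRepresentativeOnCore`, 6b-res
# `CuspidalKummerEvenExponentSquareOnCore`, 6♭‴ `KatoNeronIntegralTwoGamma1OptimalOnBlindCore` (three OPEN laws on the core at 16 ∣ N)}.  On the CM classes 6♭‴'s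
# conclusion is now a CONDITIONAL theorem by name (p2 g18 `Theorems/ManinLocalTwoThreeKatoNeronIntegralOnCMClasses.lean`, es's root laws E-es-152₂/154/155).
# HONEST FRAMING unchanged: CONDITIONAL reduction; the three laws are OPEN; BSD is not proved; Manin's conjecture at 2 is not proved.  v22 text:
# Lines/kato_shift_two.lean — v22 (lead p1 gen 15, 2026-08-29T16:2xZ): v21 with stub 6b‴ RESHAPED INTO ITS ODD-NEBENTYPUS RESIDUAL
# p2 g17 (p724791 `Theorems/ManinLocalTwoThreeSquareRootDescent.lean`, ACCEPTED) proved the TRIVIAL-CHARACTER HALF of 6b‴: a cuspidal Kummer representative of a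
# non-blind rational 2-torsion point on the core either has an odd η-exponent or has all exponents even with `∏ δ^{|r_δ/2|}` NOT a square (square-root descent
# + Newman's criterion); hence 6b‴ `CuspidalKummer.CuspidalKummerOddExponentOnCore` ⟸ the residual «all exponents even ⟹ ∏ δ^{|r_δ/2|} is a square» stated
# INLINE (p2's hypothesis `hL` VERBATIM) as `stub_cuspidalKummerEvenExponentSquareOnCore`; 6b‴ is DERIVED by `SquareRootDescent.cuspidalKummerOddExponentOnCore_of_isSquare_half`.
# By the dichotomy the residual is EQUIVALENT to 6b‴ (no loss); it is the Σ(2N)[2] / odd-quadratic-Nebentypus case of the Shimura ledger (MEMO-an §56.6), the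
# exact place where -an's E-an-151/152b character laws bite.  Stubs: {F♯, F★, F-need, F-es-21♭K, 6a‴, 6b-res, 6♭‴} (7).  HONEST FRAMING unchanged: CONDITIONAL
# reduction; the three laws are OPEN; BSD is not proved; Manin's conjecture at 2 is not proved.  v21 text:
# Lines/kato_shift_two.lean — v21 (lead p1 gen 13, 2026-08-29T08:2xZ): v20 BY NAME — ALL SEVEN STUBS ARE NAMED TREE DECLARATIONS
# The typer (g18, T-p1-g13-1, p708603 `Summits/BirchSwinnertonDyer/Rank1Residual/ManinAdditive/KatoShiftTwoCoreLaws.lean`) typed v20's three inline law stubs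
# VERBATIM as `@[conjecture]` defs: 6a‴ `CuspidalKummer.CuspidalKummerRepresentativeOnCore`, 6b‴ `CuspidalKummer.CuspidalKummerOddExponentOnCore`,
# 6♭‴ `KatoCurve.KatoNeronIntegralTwoGamma1OptimalOnBlindCore`.  v21 re-points the three stubs to those names (statements unchanged token-for-token, so the
# composition `maninOddAtFour_of_katoFact_of_levelSixteenCoreLaws_blindPeriodRecut` consumes them definitionally); stubs 1, 4, 5, 7 were already by name.
# THE OPEN CONTENT OF C2 = three NAMED laws on the core {16 ∣ N} ∩ {ord₂ j > 0} ∩ {no dyadic twist 2-semistable} + four NAMED statement-only facts.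
# HONEST FRAMING: a CONDITIONAL reduction; the three laws are OPEN; BSD is not proved by this line; Manin's conjecture at 2 is not proved.
# v20 text (kept for the record):
# Lines/kato_shift_two.lean — v20 (lead p1 gen 13, 2026-08-29T07:4xZ): v19 with p2's CORE binder «no dyadic twist is 2-semistable» on ALL THREE LAWS
# p2 g14's `maninOddAtFour_of_core` (p705358) reduces the crux to globally minimal W with 4 ∣ N, ord₂ j > 0 AND f₂(W ⊗ d) ≥ 2 for d ∈ {−1, 2, −2}
# (the complement — some dyadic twist semistable at 2 — is closed by print + the dyadic untwist transport).  The lead's 16 ∣ N reading carries this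
# binder too: the χ₋₄ partner is a MODEL of W ⊗ (−1) (`exists_optimalPartner_general_model`), the core is an isomorphism invariant
# (`twistCore_smul`: `quadraticTwist_smul` + `conductorExponent_smul'`) and survives W ↦ W ⊗ (−1) (`twistCore_negOneTwist`: (W⊗−1)⊗{−1,2,−2} ≅
# {W, W⊗−2, W⊗2}); file `Theorems/ManinLocalTwoThreeSixteenSplitCore.lean` (p1 g13).  So every law stub now carries BOTH binders
# `v₂(j) < 1` and `∀ d ∈ {−1,2,−2}, 2 ≤ f₂(W ⊗ d)` (on the datum's curve for 6a‴/6b‴, on the guard's X₀-side curve W₀ for 6♭‴).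
# THE OPEN CONTENT OF C2 after v20 = the three laws READ ON THE CORE AT 16 ∣ N (at 16 ∥ N: Kodaira rows II/4, I₀*/8, I₂*/10, I₃*/11 at 2 —
# p2/p3's row theorems): E-an-48/53 at data with a non-blind rational 2-torsion point; Kato–Néron integrality at the X₁-optimal curve of totally
# blind core classes off the period-dominated locus (in range: the X₁(32)-datum of 32a).  Stubs 1, 4, 5, 7 UNCHANGED (printed, by name).
# COMPOSITION = `maninOddAtFour_of_katoFact_of_levelSixteenCoreLaws_blindPeriodRecut` (p1 g13).
# HONEST FRAMING: a CONDITIONAL reduction; the three laws are OPEN; BSD is not proved by this line; Manin's conjecture at 2 is not proved.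
# v19 text (kept for the record):
# Lines/kato_shift_two.lean — v19 (lead p1 gen 13, 2026-08-29T07:3xZ): v18 with p2's binder «potentially supersingular at 2» (ord₂ j > 0) on ALL THREE LAWS
# p2 g14 proved C2 on the stratum ord₂ j ≤ 0 (`maninOddAtFour_of_pos_ordJ`, p704515: every potentially multiplicative / potentially good ORDINARY
# class with 4 ∣ N is a dyadic twist of a 2-semistable class — closed by the crux's own printed-fact binders + the dyadic untwist transport).
# The χ₋₄ rotation of the 16 ∣ N reading preserves j (lead p1 g13 `exists_optimalPartner_general_j`, `maninOddAtFourSS_of_maninOddAtSixteenSS`,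
# `Theorems/ManinLocalTwoThreeSixteenSplitSupersingular.lean`), and the by-locus composition consumes the laws at curves with the SAME j as the
# datum's curve (the a₁ = a₃ = 0 model) or through a guard naming it; so every law stub now carries `v₂(j) < 1` (multiplicative valuation at the
# place 2, i.e. ord₂ j > 0): 6a″ss `stub_cuspidalKummerRepresentativeAtSixteenSS`, 6b″ss `stub_cuspidalKummerOddExponentAtSixteenSS`, 6♭ss
# `stub_katoNeronIntegralTwoGamma1OptimalAtSixteenBlindSSRecut`.  v18 ⟹ v19 stub-wise (`blindSSPeriodRecutLaw_of_blindPeriodRecutLaw` etc.: a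
# binder added, never removed).  THE OPEN CONTENT OF C2 after v19: the three laws on {16 ∣ N} ∩ {potentially supersingular at 2} — E-an-48/53 at
# data with a non-blind rational 2-torsion point, Kato–Néron integrality at the X₁-optimal curve of totally blind classes off the
# period-dominated locus (in range: the X₁(32)-optimal datum of 32a — j = 1728, ord₂ j = 6).  Stubs 1, 4, 5, 7 UNCHANGED (printed, by name).
# COMPOSITION = `maninOddAtFour_of_katoFact_of_levelSixteenSSLaws_blindPeriodRecut` (p1 g13).
# HONEST FRAMING: a CONDITIONAL reduction; the three laws are OPEN; BSD is not proved by this line; Manin's conjecture at 2 is not proved.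
# v18 text (kept for the record):
# Lines/kato_shift_two.lean — v18 (lead p1 gen 13, 2026-08-29T07:0xZ): v17 with the Kato law stub restricted to TOTALLY BLIND classes (6♭)
# The lead's by-locus composition (`Theorems/ManinLocalTwoThreeManinOddByLocus.lean`, p1 g13) routes EVERY locus through the X₁(N)-optimal curve
# E₁ of the class: irreducible W[2] — F♯ gives `KatoFactTwoAt` at E₁ (`katoFactTwoAt_of_real`), the Γ₁ lever gives 2 ∤ c₁, Ling–Oesterlé +
# Ribet give |c₀| = |c₁| (NO Kato-shift lever, no E-es-22); a₁ = a₃ = 0 model with a NON-blind rational 2-torsion point — E-an-48/53 at the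
# datum + the E-an-52 theorem (no Kato input); all rational 2-torsion BLIND — Kato at E₁ + F★'s transfer.  Hence the Kato LAW is consumed ONLY on
# totally blind classes: stub 6♭ `stub_katoNeronIntegralTwoGamma1OptimalAtSixteenBlindRecut` = v17's 6⁗ (16 ∣ N, off the period-dominated locus)
# with the extra guard «the class contains a lattice-optimal, globally minimal, a₁ = a₃ = 0, totally blind X₀(N)-datum» (v14's C2¹ binders,
# Kato clothing).  6⁗ ⟹ 6♭ (`blindPeriodRecutLaw_of_periodRecutLaw`), so v18 is WEAKER than v17.  In Cremona's range the blind classes at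
# 16 ∣ N are the 7 u-family I₀* classes (HH, excused by stub 7), 80b1 (odd-HH, excused), 128b1/128d1 (HH, excused), 32a1 (open unless
# period-dominated): 6♭'s in-range content ⊆ {32a1} (es census E40 / §40.13; a census reading, not a theorem).  Stubs 1, 4, 5, 7, 6a″, 6b″
# UNCHANGED.  COMPOSITION = `maninOddAtFour_of_katoFact_of_levelSixteenLaws_blindPeriodRecut` (p1 g13).
# HONEST FRAMING: a CONDITIONAL reduction; the three laws are OPEN; BSD is not proved by this line; Manin's conjecture at 2 is not proved.
# v17 text (kept for the record):
# Lines/kato_shift_two.lean — v17 (lead p1 gen 13, 2026-08-29T07:3xZ): v16 with stub 6″ WEAKENED to 6⁗ — the PERIOD-RATIO recut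
# Kato–Néron integrality at 2 (`KatoFactTwoAt V f`) is MONOTONE in the 2-adic size of the real period: it passes from `V′` to any isogenous
# globally minimal `V` with `q·Ω(V′) = m·Ω(V)`, `q` odd, `m ∈ ℤ` (lead p1 g13 `katoFactTwoAt_of_isIsogenous_of_realPeriod_ratio`,
# `Theorems/ManinLocalTwoThreeKatoFactTwoAtPeriodRatio.lean`; p3's odd-isogeny transfer p699401 is the case `m` odd).  So stub 7 (F-es-21♭K,
# Kato at the symbol-closure curve `E_K`) discharges E-es-110 at every optimal `X₁(N)`-curve that is 2-adically DOMINATED by some symbol-closure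
# relative — stub 6⁗ `stub_katoNeronIntegralTwoGamma1OptimalAtSixteenPeriodRecut` keeps E-es-110 only OFF that locus (at `16 ∣ N`).  6″ ⟹ 6⁗
# (`recutLawPeriod_of_recutLawOddNeighbour`: an odd symbol-closure neighbour is period-dominating, odd/odd), so v17's hypothesis set is WEAKER
# than v16's; the recut is `c`-free (`Ω(E_K)/Ω(E₁)` does not see `c₁`).  Which blind classes beyond es's half-homothety locus the period recut
# excuses is a CENSUS question for es and -data (`v₂(Ω(E_K)/Ω(E₁)) ≥ 0`?; in range the blind content of 6″ was {32a1}).  Stubs 1, 4, 5, 7, 6a″, 6b″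
# UNCHANGED (names kept).  COMPOSITION = `maninOddAtFour_of_katoFact_of_levelSixteenLaws_periodRecut` (p1 g13).
# HONEST FRAMING: a CONDITIONAL reduction; the three laws are OPEN; BSD is not proved by this line; Manin's conjecture at 2 is not proved.
# v16 text (kept for the record):
# Lines/kato_shift_two.lean — v16 (lead p1 gen 13, 2026-08-29T06:2xZ): THE CRUX READ AT `16 ∣ N`, stub 6′ RECUT on the symbol-closure locus
# TRIGGER (LEAD 2026-08-29T04:58:06Z) FIRED: S-an-58 `negOneTwistConductorFourMul_holds` (p2 p696508) and S-an-60
# `negOneTwistConductorTwoMul_holds` (p2 p698743) are TREE THEOREMS and an's B5b `ManinOddAtSixteen` + glue landed (typer p698181), so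
# C2 `ManinOddAtFour` ⟺ `ManinOddAtSixteen` in the kernel with NO print input (`maninOddAtFour_iff_maninOddAtSixteen`, p2): the `χ₋₄`
# rotation moves every lattice-optimal datum with `4 ∥ N` (N′ = 4N) or `8 ∥ N` (N′ = 2N) to one with `16 ∣ N′` and the SAME constant.
# v16 = v15's composition made LEVEL-WISE (lead p1 g13, `Theorems/ManinLocalTwoThreeManinOddAtSixteenOfStubs.lean`:
# `not_two_dvd_maninConstant_of_katoFact_of_levelLaws` — every edge of v15 is local to the level) and READ AT `16 ∣ N`:
#  * stubs 1 (F♯), 4 (F★), 5 (hex) UNCHANGED, by name (printed / Literature statement-only facts);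
#  * NEW stub 7 = F-es-21♭K `kato_isIntegral_twistedSymbolSum_two_symbolClosure` BY NAME (Literature statement-only: Kato (8.1.3) +
#    Thm 12.5 (1) read at Kato's own curve `E_K = ℂ/𝓛̄_f`, Wuthrich 2014 §3) — it DISCHARGES stub 6′ on every optimal
#    `X₁(N)`-curve with a globally minimal odd-degree-isogenous symbol-closure neighbour (es g26 §40.12 (v)/§40.13: the half-homothety
#    locus, 17/21 blind classes `4 ∣ N ≤ 5000` incl. the wild 128b1/128d1, and its odd neighbours 20a1/80b1; p3's theorem
#    `katoFactTwoAt_of_oddIsogeny_of_isSymbolClosureCurve`, p699401);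
#  * stubs 6a″ / 6b″ = E-an-48 / E-an-53 READ AT `16 ∣ N` (an's `@[conjecture]` bodies VERBATIM with `4 ∣ N` ↦ `2 ^ 4 ∣ N`; inline);
#  * stub 6″ = E-es-110 READ AT `16 ∣ N` AND OFF the odd-symbol-closure-neighbour locus (inline; in range `N ≤ 5000` its only
#    totally blind class is 32a1 — es census E40/§40.13, es g27's CM target — since 40a1-type has `8 ∥ N`).
# COMPOSITION = `maninOddAtFour_of_katoFact_of_levelSixteenLaws` (p1 g13) = level-wise C2 at `16 ∣ N` + p2's
# `maninOddAtFour_of_maninOddAtSixteen'`.  7 stubs = stubs_max: 4 printed facts {F♯, F★, hex, F-es-21♭K} + 3 laws at `16 ∣ N`.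
# HONEST FRAMING: a CONDITIONAL reduction and a RE-INDEXING, not a closure; the three laws are OPEN (now on the `16 ∣ N` stratum only);
# BSD is not proved by this line; Manin's conjecture at 2 is not proved; Stevens' conjecture is not proved.
# v15 text (kept for the record):
# Lines/kato_shift_two.lean — v15 (lead p1 gen 12, 2026-08-29T02:3xZ): stub 6 C2¹ SPLIT by es g24's Γ₁ KATO ROAD and its f-intrinsic half
# DISCHARGED.  v14's stub 6 `ShimuraLedger.GammaOneOddOnBlindClasses` (C2¹) is now DERIVED: C2¹ ⟸ E-es-110 ∧ E-es-111 by the lead's tree theorem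
# `GammaOneKatoRoad.gammaOneOddOnBlindClasses_of_katoGamma1` (p688868; es g24 Sketch §3 lever, modularity-free), and E-es-111
# `KatoCurve.TwoAdicGammaOneWitnessLaw` is a THEOREM (`twoAdicGammaOneWitnessLaw_holds`, p2 g12).  So the ONE remaining input on the totally
# blind locus is the NÉRON HALF, stub 6′ = E-es-110 `KatoCurve.KatoNeronIntegralTwoGamma1Optimal`.  Hypothesis set of C2 after v15:
# {stub 1 F♯, stub 6′ E-es-110} + {E-an-48, E-an-53} + {F★, hex}.  COMPOSITION = p683655 + p688868.
# History: v6 (4ce672ceda68) … v8 (cb94b66fa4ba) five named stubs; v9 (fe79704d5fa5) TWO stubs {F♯, Rb}; v10 (7384bfbaa501) Rb derived from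
# cuspidal-Kummer stubs + blind residual; v11/v12/v13: all stubs by name; v14 (603f697eaeb8) blind residual through Stevens' parity;
# v15 (2e2d80f2578c) C2¹ split by the Γ₁ Kato road.
-/

set_option autoImplicit false
set_option linter.dupNamespace false

noncomputable section

open scoped Classical MatrixGroups ModularForm NumberField PeriodPair Manifold
open IsDedekindDomain IsDedekindDomain.HeightOneSpectrum Rat.HeightOneSpectrum
open PowerSeries CongruenceSubgroup WeierstrassCurve Literature.NumberTheory.EllipticCurves
  Literature.NumberTheory.EllipticCurves.ModularForms
  Literature.RingTheory.FormalGroups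
  Summit.BirchSwinnertonDyer.Rank1Residual.ManinAdditive
  Summit.BirchSwinnertonDyer.Rank1Residual.ManinAdditive.CuspidalKummer
  Summit.BirchSwinnertonDyer.Rank1Residual.ManinAdditive.ShimuraLedger
  Summit.BirchSwinnertonDyer.Rank1Residual.ManinAdditive.KatoCurve
  Summit.BirchSwinnertonDyer.BirchSwinnertonDyer.Theorems.ManinLocalTwoThree.SigmaSquareRoot

namespace Summit.BirchSwinnertonDyer.BirchSwinnertonDyer.Cruxes.ManinOddAtFour.KatoShiftTwo

/-- STUB (PRINTED bundle, Kato 2004): F♯ `kato_neron_isIntegral_twistedSymbolSum_of_additive_two_real` (Kato Thm 12.5 (1), real subfield; closes the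
`W[2]`-irreducible locus) ∧ F-es-21♭K `kato_isIntegral_twistedSymbolSum_two_symbolClosure` (Kato (8.1.3) + Thm 12.5 (1) at the symbol-closure curve; discharges
6♭‴ on the period-dominated locus).  Statement-only Literature facts; close by Literature PROOFS, not inside this line (XL). -/
theorem stub_printedKatoFacts :
    kato_neron_isIntegral_twistedSymbolSum_of_additive_two_real ∧ kato_isIntegral_twistedSymbolSum_two_symbolClosure := by
  sorry

/-- STUB (PRINTED bundle, CES 2003 / Stevens 1982 / Stevens 1989): F★ `optimalGamma1Parametrization_cusp_rational` (CES §6.1.2) ∧ F♮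
`optimalGamma1Parametrization_cuspZero_galoisConjugate` (Stevens 1982 Thm 1.3.1 (b); NEW on this line — feeds Θ) ∧ CES `exists_optimal_gamma1ParametrizationData`
(CES Thm 1.1.3 / Stevens Thm 1.9).  Statement-only Literature facts (the same three are stubs of C3's v34). -/
theorem stub_printedCuspFacts :
    optimalGamma1Parametrization_cusp_rational ∧ optimalGamma1Parametrization_cuspZero_galoisConjugate ∧
      exists_optimal_gamma1ParametrizationData := by
  sorry

/-- STUB (PRINTED) CDT-algInt — Calegari–Dimitrov–Tang 2025 Thm. 1.0.1 with Remarks 58–59 (Unbounded Denominators, algebraic-integer coefficients), the vendored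
statement-only fact `Literature.NumberTheory.Automorphic.CalegariDimitrovTang2025_unboundedDenominators_algInt` (the same stub as C3 v34's `stub_CDT_algInt`);
unbundled to `∀ k, UnboundedDenominatorsWeightAlgInt k` by p2's `UDWOfCDT.unboundedDenominatorsWeightAlgInt_of_CDT_algInt`.  CITE-ONLY. -/
theorem stub_CDT_algInt : Literature.NumberTheory.Automorphic.CalegariDimitrovTang2025_unboundedDenominators_algInt := by
  sorry

/-- STUB I4 = E-an-152b ON THE GAIN LOCUS (`ShimuraIndexNeFourAtFour`, -an; B-form `KummerShimuraTwo.ShimuraIndexNeFourAtFourB`, T-an-58) with the binders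
`16 ∣ N`, core, `{∞,0}_f ∉ Λ₀(f)`, `Λ₁(f) ≠ Λ₀(f)`, `a₁ = a₃ = 0`: **the Shimura kernel never swallows `E₀[2]`** — `Λ₁(f) ≠ 2Λ₀(f)` (index `4` is E-an-68's
configuration `E₁ ≅ E₀`, `c₀ = ±2c₁`).  OPEN, c-free, f-intrinsic; es E15: 21/21 gain classes at `16 ∣ N` have index `2`. -/
theorem stub_shimuraIndexNeFourOnCoreG :
    ∀ (W : WeierstrassCurve ℚ) [W.IsElliptic] [W.IsGloballyMinimal] {N : ℕ} [NeZero N] (D : ModularParametrizationData W N),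
      2 ^ 4 ∣ N → (∀ z ∈ D.L.lattice, ∃ w ∈ periodLattice D.f, z = D.c * w) →
      ((primesEquiv (R := 𝓞 ℚ)).symm ⟨2, Nat.prime_two⟩).valuation ℚ W.j < 1 →
      (∀ d : ℤ, d = -1 ∨ d = 2 ∨ d = -2 → 2 ≤ (W.quadraticTwist (d : ℚ)).conductorExponent ((primesEquiv (R := ℤ)).symm ⟨2, Nat.prime_two⟩)) →
      modularSymbol D.f 0 ∉ periodLattice D.f → periodLatticeGamma1 D.f ≠ periodLattice D.f → W.a₁ = 0 → W.a₃ = 0 →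
      ¬ (∀ z : ℂ, z ∈ periodLatticeGamma1 D.f ↔ ∃ w ∈ periodLattice D.f, z = 2 * w) := by
  sorry

/-- STUB K♭ = E-an-152♭ ON THE GAIN LOCUS (E-an-152 `ShimuraKernelBlindAtFour`, -an; B-form `KummerShimuraTwo.ShimuraKernelBlindAtFourB`, T-an-58 — with its
`℘`-clause DROPPED and the binders `16 ∣ N`, core, `{∞,0}_f ∉ Λ₀(f)`, `a₁ = a₃ = 0`): **a gain class of index `≠ 4` has a Kummer-BLIND rational `2`-division
root** (the generator of `E₀ ∩ Σ(N) = ker(E₀ → E₁)`; Vatsal's multiplicative-type mechanism at `ℓ = 2`).  OPEN, c-free; -an §87: 19/19 at `4 ∣ N ≤ 2000`. -/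
theorem stub_blindRationalRootOnCoreG :
    ∀ (W : WeierstrassCurve ℚ) [W.IsElliptic] [W.IsGloballyMinimal] {N : ℕ} [NeZero N] (D : ModularParametrizationData W N),
      2 ^ 4 ∣ N → (∀ z ∈ D.L.lattice, ∃ w ∈ periodLattice D.f, z = D.c * w) →
      ((primesEquiv (R := 𝓞 ℚ)).symm ⟨2, Nat.prime_two⟩).valuation ℚ W.j < 1 →
      (∀ d : ℤ, d = -1 ∨ d = 2 ∨ d = -2 → 2 ≤ (W.quadraticTwist (d : ℚ)).conductorExponent ((primesEquiv (R := ℤ)).symm ⟨2, Nat.prime_two⟩)) →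
      modularSymbol D.f 0 ∉ periodLattice D.f → periodLatticeGamma1 D.f ≠ periodLattice D.f → W.a₁ = 0 → W.a₃ = 0 →
      ¬ (∀ z : ℂ, z ∈ periodLatticeGamma1 D.f ↔ ∃ w ∈ periodLattice D.f, z = 2 * w) →
      ∃ A₂ A₄ E : ℤ, (A₂ : ℚ) = W.a₂ ∧ (A₄ : ℚ) = W.a₄ ∧
        (E : ℚ) ^ 3 + W.a₂ * (E : ℚ) ^ 2 + W.a₄ * E + W.a₆ = 0 ∧ KummerBlindAtTwo A₂ A₄ E := by
  sorry

/-- STUB 6♭‴|_G — `KatoCurve.KatoNeronIntegralTwoGamma1OptimalOnBlindCore` (v23's stub, typer p708603) RESTRICTED to the gain locus G: the guard's lattice-optimal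
blind core datum `D₀` also has `modularSymbol D₀.f 0 ∉ periodLattice D₀.f` AND `periodLatticeGamma1 D₀.f ≠ periodLattice D₀.f` (Stevens' curve `V` is NOT the
optimal curve `W₀`).  OPEN (Stevens' 2-part on blind gain classes, in Kato clothing); strictly weaker than 6♭‴|_B. -/
theorem stub_katoNeronIntegralTwoGamma1OptimalOnBlindCoreG :
    ∀ (V : WeierstrassCurve ℚ) [V.IsElliptic] [V.IsGloballyMinimal] {N : ℕ} [NeZero N]
      (D₁ : Gamma1ParametrizationData V N), D₁.IsOptimal → 2 ^ 4 ∣ N →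
      (¬ ∃ (V' : WeierstrassCurve ℚ) (_ : V'.IsElliptic) (_ : V'.IsGloballyMinimal) (q m : ℤ),
        Odd q ∧ WeierstrassCurve.IsIsogenous V' V ∧ (q : ℝ) * V'.realPeriodRat = (m : ℝ) * V.realPeriodRat ∧
        IsSymbolClosureCurve V' D₁.f) →
      (∃ (W₀ : WeierstrassCurve ℚ) (_ : W₀.IsElliptic) (_ : W₀.IsGloballyMinimal) (D₀ : ModularParametrizationData W₀ N),
        IsIsogenous V W₀ ∧ (∀ z ∈ D₀.L.lattice, ∃ w ∈ periodLattice D₀.f, z = D₀.c * w) ∧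
        W₀.a₁ = 0 ∧ W₀.a₃ = 0 ∧ HasRationalTwoTorsion W₀ ∧ AllRationalTwoTorsionBlind W₀ ∧
        ((primesEquiv (R := 𝓞 ℚ)).symm ⟨2, Nat.prime_two⟩).valuation ℚ W₀.j < 1 ∧
        (∀ d : ℤ, d = -1 ∨ d = 2 ∨ d = -2 → 2 ≤ (W₀.quadraticTwist (d : ℚ)).conductorExponent ((primesEquiv (R := ℤ)).symm ⟨2, Nat.prime_two⟩)) ∧
        modularSymbol D₀.f 0 ∉ periodLattice D₀.f ∧ periodLatticeGamma1 D₀.f ≠ periodLattice D₀.f) →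
      KatoFactTwoAt V D₁.f := by
  sorry

/-- COMPOSITION (no sorry): `KernelSplit.maninOddAtFour_of_katoFact_CDT_kernelLawsG` (p3 g18) fed with the six stubs (two printed bundles unpacked; AN2₂ and
the UDC₂ roads are THEOREMS inside the composition). -/
theorem ManinOddAtFour_of :
    Summit.BirchSwinnertonDyer.BirchSwinnertonDyer.Theses.ManinLocalTwoThree.ManinOddAtFour :=
  Summit.BirchSwinnertonDyer.BirchSwinnertonDyer.Theorems.ManinLocalTwoThree.KernelSplit.maninOddAtFour_of_katoFact_CDT_kernelLawsG
    stub_printedKatoFacts.1 stub_printedCuspFacts.1 stub_printedCuspFacts.2.1 stub_printedCuspFacts.2.2 stub_printedKatoFacts.2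
    stub_CDT_algInt stub_shimuraIndexNeFourOnCoreG stub_blindRationalRootOnCoreG stub_katoNeronIntegralTwoGamma1OptimalOnBlindCoreG

end Summit.BirchSwinnertonDyer.BirchSwinnertonDyer.Cruxes.ManinOddAtFour.KatoShiftTwo

end
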